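import Summits.Ventures.Crystal3D.Bulk.GapRattlerHosting
import Summits.Ventures.Crystal3D.Bulk.GapHexagonPacking
import HarnessLib

/-!
# P-L3(h): a census configuration has at most two rattlers, modulo (d3) «one rattler per
# p-hexagon» — the composition of p3's (d1)(d2) `Bulk/GapRattlerHosting` with the hexagon
# packing of `Bulk/GapHexagonPacking`

HONEST FRAMING. Part of the venture `Summits/Ventures/Crystal3D` (cell `pub-crystal3d`, phase 2;
seat typer-bulk-2, composing with p3's chain). Kernel theorem about every configuration
satisfying `CensusRows c`; nothing is claimed about GAP(1.26). Row P-L3(h) of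
`DESIGN-L12-THEORY.md` («`r ≤ 2`», the rattler-count cut of the census universe,
`TARGET-GAP.md` §4.4) has three ingredients: (d1)(d2) every rattler direction lies in (the corner
fan of) a `p`-HEXAGON — KERNEL, `CensusRows.exists_hexagon_of_rattler` (p3); the COUNT
`4 · #hexagons + #rattlers ≤ 12` — KERNEL, `CensusRows.hexagon_packing`; and (d3) «no `p`-hexagon
hosts two rattlers» — the numeric HEX-PERIMETER premise, which stays a HYPOTHESIS here, stated
on the in-darts `(a, 13)` of the hexagons with p3's `InCornerFan`:

* `CensusRows.exists_hosting_hexagon_dart` — every rattler `j` is hosted by the hexagon of some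
  dart `(a, 13)` into the hole (`a ∈ H`), in the corner-fan sense;
* **`CensusRows.card_rattlers_le_two`** — (d3) ⇒ `#rattlers ≤ 2`.
-/

noncomputable section

namespace Summit.Ventures.Crystal3D

open Literature.Geometry.DiscreteGeometry Finset Equiv HullRotSys Function

variable {c : Fin 14 → EuclideanSpace ℝ (Fin 3)}

/-- A shell ball outside `activeVertices c` has no tight partner (the rattler hypothesis of
`Bulk/GapRattlerHosting.lean`). -/
theorem forall_dist_ne_one_of_not_mem_activeVertices {j : Fin 14} (hj0 : j ≠ 0)
    (hj : j ∉ activeVertices c) : ∀ k : Fin 14, k ≠ 0 → k ≠ j → dist (c j) (c k) ≠ 1 := by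
  intro k hk0 hkj hd
  exact hj (mem_activeVertices.2 ⟨hj0, ⟨k, mem_tightNbrs.2 ⟨hk0, hkj, hd⟩⟩⟩)

/-- The in-dart `(a, 13)` of a tight partner `a` of the hole is a dart. -/
theorem mk_thirteen_mem_darts {a : Fin 14} (ha : a ∈ tightNbrs c 13) : (a, (13 : Fin 14)) ∈ darts c :=
  swap_mem_darts (mk_mem_darts (by decide) ha)

/-- **Every rattler is hosted by the hexagon of a dart into the hole.** For a rattler `j` there is
a tight partner `a` of the hole with `ofaceLen c (a, 13) = 6` such that `gapDir c j` lies in the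
corner fan of the oriented face of `(a, 13)` (p3's `exists_hexagon_of_rattler`, re-based at the
face's dart into the hole by `InCornerFan.shift`). -/
theorem CensusRows.exists_hosting_hexagon_dart (h : CensusRows c) {j : Fin 14} (hj0 : j ≠ 0)
    (hj13 : j ≠ 13) (hj : j ∉ activeVertices c) :
    ∃ a : Fin 14, ∃ ha : a ∈ tightNbrs c 13, ofaceLen c (a, 13) = 6 ∧
      InCornerFan h.isGapConfig.norm_of_mem_activeDirSet
        h.zero_mem_interior_convexHull_activeDirSet (tightDartsIn c (activeDirSet c))
        ⟨dirPair c (a, 13), h.dirPair_mem_hullDarts_active _ (mk_thirteen_mem_darts ha)⟩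
        (gapDir c j) := by
  obtain ⟨hD3, -, -⟩ := h.intruderDist_bounds
  have hratt := forall_dist_ne_one_of_not_mem_activeVertices hj0 hj
  obtain ⟨q, hq, hfan, h6, hhole⟩ := h.exists_hexagon_of_rattler hj0 hj13 hratt
  obtain ⟨a, haH, hface⟩ := h.exists_mem_hexagons_of_face hq h6 hhole
  obtain ⟨ha, ha6⟩ := mem_filter.1 haH
  refine ⟨a, ha, ha6, ?_⟩
  -- `(a, 13)` lies on the face of `q`: it is an iterate `φ°^[r] q`
  have hper := h.isGapConfig.mem_periodicPts_ofaceSucc hD3 hq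
  have hmem : (a, (13 : Fin 14)) ∈ ofaceOf c q := by
    rw [← hface]
    exact self_mem_ofaceOf (h.isGapConfig.mem_periodicPts_ofaceSucc hD3 (mk_thirteen_mem_darts ha))
  obtain ⟨r, hr⟩ := (mem_ofaceOf_iff hper).1 hmem
  -- the `r`-th dart of the walk of `q` in the active hull IS the dart of `(a, 13)`
  have hshift := hfan.shift r
  have heq : faceDart h.isGapConfig.norm_of_mem_activeDirSet
      h.zero_mem_interior_convexHull_activeDirSet (tightDartsIn c (activeDirSet c))
      ⟨dirPair c q, h.dirPair_mem_hullDarts_active q hq⟩ r =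
      ⟨dirPair c (a, 13), h.dirPair_mem_hullDarts_active _ (mk_thirteen_mem_darts ha)⟩ := by
    apply Subtype.ext
    unfold faceDart
    rw [h.isGapConfig.phi_pow_rot_val_of h.intruderDist_lt_three_halves _ _
      h.dirPair_mem_hullDarts_active hq rfl r, hr]
  rw [heq] at hshift
  exact hshift

/-- **P-L3(h): at most two rattlers, modulo (d3).** If no `p`-hexagon hosts two rattlers — for
all rattlers `j, j'` and every tight partner `a` of the hole with `ofaceLen c (a, 13) = 6`, if
both `gapDir c j` and `gapDir c j'` lie in the corner fan of the face of `(a, 13)` then `j = j'`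
(the HEX-PERIMETER premise (d3), a hypothesis here) — then the configuration has at most `2`
rattlers: every rattler is hosted by a `p`-hexagon ((d1)(d2), kernel), hosting is injective
((d3)), and `4 · #hexagons + #rattlers ≤ 12` (`CensusRows.hexagon_packing`). -/
theorem CensusRows.card_rattlers_le_two (h : CensusRows c)
    (hd3 : ∀ j j' : Fin 14, j ≠ 0 → j ≠ 13 → j ∉ activeVertices c → j' ≠ 0 → j' ≠ 13 →
      j' ∉ activeVertices c → ∀ a : Fin 14, ∀ ha : a ∈ tightNbrs c 13, ofaceLen c (a, 13) = 6 →
      InCornerFan h.isGapConfig.norm_of_mem_activeDirSet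
        h.zero_mem_interior_convexHull_activeDirSet (tightDartsIn c (activeDirSet c))
        ⟨dirPair c (a, 13), h.dirPair_mem_hullDarts_active _ (mk_thirteen_mem_darts ha)⟩
        (gapDir c j) →
      InCornerFan h.isGapConfig.norm_of_mem_activeDirSet
        h.zero_mem_interior_convexHull_activeDirSet (tightDartsIn c (activeDirSet c))
        ⟨dirPair c (a, 13), h.dirPair_mem_hullDarts_active _ (mk_thirteen_mem_darts ha)⟩
        (gapDir c j') → j = j') :
    (univ.filter fun j : Fin 14 => j ≠ 0 ∧ j ≠ 13 ∧ j ∉ activeVertices c).card ≤ 2 := by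
  classical
  -- choose a hosting hexagon for every rattler
  have host : ∀ j : Fin 14, ∃ a : Fin 14, (j ≠ 0 ∧ j ≠ 13 ∧ j ∉ activeVertices c) →
      ∃ ha : a ∈ tightNbrs c 13, ofaceLen c (a, 13) = 6 ∧
        InCornerFan h.isGapConfig.norm_of_mem_activeDirSet
          h.zero_mem_interior_convexHull_activeDirSet (tightDartsIn c (activeDirSet c))
          ⟨dirPair c (a, 13), h.dirPair_mem_hullDarts_active _ (mk_thirteen_mem_darts ha)⟩
          (gapDir c j) := by
    intro j
    by_cases hj : j ≠ 0 ∧ j ≠ 13 ∧ j ∉ activeVertices c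
    · obtain ⟨a, ha, ha6, hfan⟩ := h.exists_hosting_hexagon_dart hj.1 hj.2.1 hj.2.2
      exact ⟨a, fun _ => ⟨ha, ha6, hfan⟩⟩
    · exact ⟨0, fun h' => absurd h' hj⟩
  choose f hf using host
  refine h.card_rattlers_le_two_of_hosting f ?_ ?_
  · intro j hj
    obtain ⟨ha, ha6, -⟩ := hf j (mem_filter.1 hj).2
    exact mem_filter.2 ⟨ha, ha6⟩
  · intro j hj j' hj' hff
    have hjR := (mem_filter.1 (Finset.mem_coe.1 hj)).2
    have hj'R := (mem_filter.1 (Finset.mem_coe.1 hj')).2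
    obtain ⟨ha, ha6, hfan⟩ := hf j hjR
    obtain ⟨ha', -, hfan'⟩ := hf j' hj'R
    -- `f j = f j'`: the second hosting statement is about the same dart
    have hd : (⟨dirPair c (f j', 13), h.dirPair_mem_hullDarts_active _ (mk_thirteen_mem_darts ha')⟩ :
        ↥(hullDarts (activeDirSet c))) =
        ⟨dirPair c (f j, 13), h.dirPair_mem_hullDarts_active _ (mk_thirteen_mem_darts ha)⟩ := by
      apply Subtype.ext
      show dirPair c (f j', 13) = dirPair c (f j, 13)
      rw [hff]
    rw [hd] at hfan'
    exact hd3 j j' hjR.1 hjR.2.1 hjR.2.2 hj'R.1 hj'R.2.1 hj'R.2.2 (f j) ha ha6 hfan hfan'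

end Summit.Ventures.Crystal3D
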